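import Literature.Probability.Process.KolmogorovExtensionProofs
import Literature.Probability.Process.PathSpaceBorel
import Mathlib.Topology.UniformSpace.CompactConvergence
import Mathlib.Topology.MetricSpace.Polish
import Mathlib.Topology.ContinuousMap.SecondCountableSpace
import HarnessLib

/-!
# Two-sided extension of a stationary continuous process

Trunk T-PROBABILITY (Literature/Probability/Process). Definitions (path operations) and theorems.
A **stationary law of continuous one-sided paths** — a Borel probability measure `ν` on
`C([0, ∞), ℝ)` invariant under every time shift `z ↦ z(h + ·)`, `h ≥ 0` — **extends to a
shift-invariant Borel probability measure `P` on the two-sided path space `C(ℝ, ℝ)`** whose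
restriction to every half-line `[-N, ∞)` is `ν` started at time `-N`
(`exists_twoSided_extension`): with the path operations

* `shiftPath h z = z(h + ·)` on `C(ℝ≥0, ℝ)`,
* `extendPath N z = z((· + N)⁺)` : `C(ℝ≥0, ℝ) → C(ℝ, ℝ)` (start `z` at time `-N`, frozen before),
* `clampPath N x = x(· ∨ (-N))` on `C(ℝ, ℝ)` (freeze `x` before `-N`),
* `twoShift s x = x(s + ·)` on `C(ℝ, ℝ)`,

`P` is characterised by `P ∘ (clampPath N)⁻¹ = ν ∘ (extendPath N)⁻¹` for all `N : ℕ`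
(`Measure.ext_of_map_clampPath`: such identities determine a finite measure on `C(ℝ, ℝ)`), and then
`P ∘ (twoShift s)⁻¹ = P` for every `s ∈ ℝ` (`map_twoShift_eq_of_map_clampPath`).

Construction: the Kolmogorov extension theorem of the tree
(`Literature.Probability.Process.exists_isProjectiveLimit_holds`) on the countable index set `ℕ`
with the Polish coordinate space `C(ℝ, ℝ)` (complete for the compact-open uniformity, second
countable): the coordinates are the paths frozen before `-n`, the finite-dimensional laws
`ν ∘ (z ↦ (extendPath n (shiftPath (N - n) z))_{n ∈ J})⁻¹` (`N = max J`) are projective by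
stationarity, consecutive coordinates are a.s. consistent (`Vₙ = clampPath n V_{n+1}`), and the
two-sided path is glued as `t ↦ V_{⌈|t|⌉}(t)`. This is the standard remark that a stationary
process indexed by `[0, ∞)` extends uniquely to a stationary process indexed by `ℝ` (e.g.
Kallenberg (2002), Lemma 10.2 / proof via Kolmogorov's theorem; Doob (1953), Ch. X §1), here for
continuous paths and at the level of laws on path space.

## References

* O. Kallenberg, *Foundations of Modern Probability*, 2nd ed. (2002), Thm 6.16 (Kolmogorov
  extension), Ch. 10 (stationary processes). [Kallenberg2002]
* J. L. Doob, *Stochastic Processes* (1953), Ch. X §1.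
-/

noncomputable section

open MeasureTheory Filter Topology Set Function
open scoped NNReal ENNReal

namespace Literature.Probability.Process

/-! ### Path operations -/

section PathOps

/-- **Time shift of a one-sided path**: `shiftPath h z = z(h + ·)`. [folklore] -/
def shiftPath (h : ℝ≥0) (z : C(ℝ≥0, ℝ)) : C(ℝ≥0, ℝ) :=
  z.comp ⟨fun u ↦ h + u, continuous_const.add continuous_id⟩

/-- Value of a shifted path. [folklore] -/
@[simp] theorem shiftPath_apply (h : ℝ≥0) (z : C(ℝ≥0, ℝ)) (u : ℝ≥0) : shiftPath h z u = z (h + u) := rfl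

/-- The shift by `0` is the identity. [folklore] -/
@[simp] theorem shiftPath_zero (z : C(ℝ≥0, ℝ)) : shiftPath 0 z = z := by ext u; simp

/-- Shifts compose additively: `σ_a (σ_b z) = σ_{b + a} z`. [folklore] -/
theorem shiftPath_shiftPath (a b : ℝ≥0) (z : C(ℝ≥0, ℝ)) :
    shiftPath a (shiftPath b z) = shiftPath (b + a) z := by
  ext u; simp [add_assoc]

/-- The shift is continuous (compact-open topology). [folklore] -/
theorem continuous_shiftPath (h : ℝ≥0) : Continuous (shiftPath h) := ContinuousMap.continuous_precomp _

/-- **Extension of a one-sided path to a two-sided one started at time `-N`** (constant before):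
`extendPath N z (t) = z((t + N)⁺)`. [folklore] -/
def extendPath (N : ℕ) (z : C(ℝ≥0, ℝ)) : C(ℝ, ℝ) :=
  z.comp ⟨fun t : ℝ ↦ (t + N).toNNReal, continuous_real_toNNReal.comp (continuous_id.add continuous_const)⟩

/-- Value of an extended path. [folklore] -/
@[simp] theorem extendPath_apply (N : ℕ) (z : C(ℝ≥0, ℝ)) (t : ℝ) :
    extendPath N z t = z (t + N).toNNReal := rfl

/-- The extension is continuous. [folklore] -/
theorem continuous_extendPath (N : ℕ) : Continuous (extendPath N) := ContinuousMap.continuous_precomp _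

/-- **Freezing a two-sided path before time `-N`**: `clampPath N x (t) = x(t ∨ (-N))`. [folklore] -/
def clampPath (N : ℕ) (x : C(ℝ, ℝ)) : C(ℝ, ℝ) :=
  x.comp ⟨fun t : ℝ ↦ max t (-(N : ℝ)), continuous_id.max continuous_const⟩

/-- Value of a clamped path. [folklore] -/
@[simp] theorem clampPath_apply (N : ℕ) (x : C(ℝ, ℝ)) (t : ℝ) : clampPath N x t = x (max t (-(N : ℝ))) := rfl

/-- The clamp is continuous. [folklore] -/
theorem continuous_clampPath (N : ℕ) : Continuous (clampPath N) := ContinuousMap.continuous_precomp _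

/-- The clamp does not change the values from `-N` on. [folklore] -/
theorem clampPath_apply_of_le {N : ℕ} {t : ℝ} (ht : -(N : ℝ) ≤ t) (x : C(ℝ, ℝ)) : clampPath N x t = x t := by
  rw [clampPath_apply, max_eq_left ht]

/-- **Time shift of a two-sided path**: `twoShift s x = x(s + ·)`. [folklore] -/
def twoShift (s : ℝ) (x : C(ℝ, ℝ)) : C(ℝ, ℝ) :=
  x.comp ⟨fun t ↦ s + t, continuous_const.add continuous_id⟩

/-- Value of a shifted two-sided path. [folklore] -/
@[simp] theorem twoShift_apply (s : ℝ) (x : C(ℝ, ℝ)) (t : ℝ) : twoShift s x t = x (s + t) := rfl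

/-- The two-sided shift is continuous. [folklore] -/
theorem continuous_twoShift (s : ℝ) : Continuous (twoShift s) := ContinuousMap.continuous_precomp _

/-- **Clamping an extended path**: for `n ≤ M`, `clampPath n (extendPath M z) = extendPath n (shiftPath (M - n) z)`.
[folklore] -/
theorem clampPath_extendPath {n M : ℕ} (hnM : n ≤ M) (z : C(ℝ≥0, ℝ)) :
    clampPath n (extendPath M z) = extendPath n (shiftPath ((M - n : ℕ) : ℝ≥0) z) := by
  ext t
  simp only [clampPath_apply, extendPath_apply, shiftPath_apply]
  congr 1
  apply NNReal.eq
  have hcast : ((M - n : ℕ) : ℝ) = (M : ℝ) - n := Nat.cast_sub hnM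
  rw [NNReal.coe_add, NNReal.coe_natCast, hcast]
  rcases le_total (t + n) 0 with h | h
  · rw [Real.coe_toNNReal', Real.coe_toNNReal', max_eq_right h]
    have : max t (-(n : ℝ)) = -(n : ℝ) := max_eq_right (by linarith)
    rw [this, max_eq_left (by have := (Nat.cast_le (α := ℝ)).2 hnM; linarith)]
    ring
  · rw [Real.coe_toNNReal', Real.coe_toNNReal', max_eq_left h]
    have : max t (-(n : ℝ)) = t := max_eq_left (by linarith)
    rw [this, max_eq_left (by have := (Nat.cast_le (α := ℝ)).2 hnM; linarith)]
    ring

end PathOps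

/-! ### Measures on `C(ℝ, ℝ)` are determined by their clamps -/

section Determined

variable [MeasurableSpace C(ℝ, ℝ)] [BorelSpace C(ℝ, ℝ)]

/-- The path operations are Borel measurable. [folklore] -/
theorem measurable_clampPath (N : ℕ) : Measurable (clampPath N) := (continuous_clampPath N).measurable

/-- The two-sided shift is Borel measurable. [folklore] -/
theorem measurable_twoShift (s : ℝ) : Measurable (twoShift s) := (continuous_twoShift s).measurable

/-- **A finite Borel measure on `C(ℝ, ℝ)` is determined by its images under all the clamps
`clampPath N`** (every finite-dimensional distribution factors through a clamp).
[cite: Billingsley1999, Example 1.3] -/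
theorem _root_.MeasureTheory.Measure.ext_of_map_clampPath {P P' : Measure C(ℝ, ℝ)} [IsFiniteMeasure P]
    (h : ∀ N : ℕ, P.map (clampPath N) = P'.map (clampPath N)) : P = P' := by
  refine measure_continuousMap_ext_of_fdd fun I ↦ ?_
  -- a clamp level below all the times of `I`
  obtain ⟨N, hN⟩ : ∃ N : ℕ, ∀ i ∈ I, -(N : ℝ) ≤ i := by
    obtain ⟨N, hN⟩ := exists_nat_ge (∑ j ∈ I, |j|)
    refine ⟨N, fun i hi ↦ ?_⟩
    have h1 : |i| ≤ ∑ j ∈ I, |j| := Finset.single_le_sum (fun j _ ↦ abs_nonneg j) hi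
    linarith [neg_abs_le i]
  have hfac : (fun (x : C(ℝ, ℝ)) (i : I) ↦ x i) = (fun (x : C(ℝ, ℝ)) (i : I) ↦ x i) ∘ clampPath N := by
    funext x; funext i
    simp [clampPath_apply_of_le (hN i i.2)]
  have hmeas : Measurable fun (x : C(ℝ, ℝ)) (i : I) ↦ x i :=
    measurable_pi_lambda _ fun i ↦ (continuous_eval_const (i : ℝ)).measurable
  rw [hfac, ← Measure.map_map hmeas (measurable_clampPath N), ← Measure.map_map hmeas (measurable_clampPath N),
    h N]

/-- **Shift invariance from the clamp identities.** If the clamps of `P` are the extensions of a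
shift-invariant `ν` — `P ∘ (clampPath N)⁻¹ = ν ∘ (extendPath N)⁻¹` for all `N` — then `P` is
invariant under every two-sided time shift. [folklore] -/
theorem map_twoShift_eq_of_map_clampPath [MeasurableSpace C(ℝ≥0, ℝ)] [BorelSpace C(ℝ≥0, ℝ)]
    {ν : Measure C(ℝ≥0, ℝ)} (hν : ∀ h : ℝ≥0, ν.map (shiftPath h) = ν)
    {P : Measure C(ℝ, ℝ)} [IsFiniteMeasure P] (hP : ∀ N : ℕ, P.map (clampPath N) = ν.map (extendPath N))
    (s : ℝ) : P.map (twoShift s) = P := by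
  haveI : IsFiniteMeasure (P.map (twoShift s)) := Measure.isFiniteMeasure_map _ _
  refine Measure.ext_of_map_clampPath fun N ↦ ?_
  -- `clampPath N ∘ twoShift s = Ψ ∘ clampPath M`, `M = N + ⌈|s|⌉`
  set M : ℕ := N + ⌈|s|⌉₊ with hM
  have hMs : -(M : ℝ) ≤ s - N := by
    have h1 : |s| ≤ (⌈|s|⌉₊ : ℝ) := Nat.le_ceil _
    have h2 : (M : ℝ) = N + ⌈|s|⌉₊ := by rw [hM]; push_cast; ring
    linarith [neg_abs_le s]
  set Ψ : C(ℝ, ℝ) → C(ℝ, ℝ) := fun y ↦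
    y.comp ⟨fun t ↦ max (s + t) (s - N), (continuous_const.add continuous_id).max continuous_const⟩ with hΨ
  have hΨc : Continuous Ψ := ContinuousMap.continuous_precomp _
  have hfac : clampPath N ∘ twoShift s = Ψ ∘ clampPath M := by
    funext x; ext t
    simp only [comp_apply, clampPath_apply, twoShift_apply, hΨ, ContinuousMap.comp_apply, ContinuousMap.coe_mk]
    rw [max_eq_left (le_trans hMs (le_max_right _ _))]
    congr 1
    rcases le_total t (-(N : ℝ)) with h | h
    · rw [max_eq_right h, max_eq_right (by linarith)]; ring
    · rw [max_eq_left h, max_eq_left (by linarith)]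
  -- `Ψ ∘ extendPath M = extendPath N ∘ shiftPath h`, `h = s - N + M ≥ 0`
  have hh0 : 0 ≤ s - N + M := by linarith
  set h : ℝ≥0 := (s - N + M).toNNReal with hhdef
  have hh : (h : ℝ) = s - N + M := Real.coe_toNNReal _ hh0
  have hfac2 : Ψ ∘ extendPath M = extendPath N ∘ shiftPath h := by
    funext z; ext t
    simp only [comp_apply, hΨ, ContinuousMap.comp_apply, ContinuousMap.coe_mk, extendPath_apply, shiftPath_apply]
    congr 1
    apply NNReal.eq
    rw [NNReal.coe_add, hh]
    have h1 : 0 ≤ max (s + t) (s - N) + M := by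
      have := le_max_right (s + t) (s - N); linarith
    rw [Real.coe_toNNReal _ h1, Real.coe_toNNReal']
    rcases le_total (t + N) 0 with h2 | h2
    · rw [max_eq_right h2, max_eq_right (by linarith)]; ring
    · rw [max_eq_left h2, max_eq_left (by linarith)]; ring
  rw [Measure.map_map (measurable_clampPath N) (measurable_twoShift s), hfac,
    ← Measure.map_map hΨc.measurable (measurable_clampPath M), hP M,
    Measure.map_map hΨc.measurable (continuous_extendPath M).measurable, hfac2,
    ← Measure.map_map (continuous_extendPath N).measurable (continuous_shiftPath h).measurable, hν h, hP N]

end Determined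

/-! ### The extension theorem -/

section Extension

/-- The coordinate maps of the projective family: `z ↦ (extendPath n (shiftPath (N - n) z))_{n ∈ J}`. [folklore] -/
def coordFamily (J : Finset ℕ) (N : ℕ) (z : C(ℝ≥0, ℝ)) : ∀ _ : J, C(ℝ, ℝ) :=
  fun n ↦ extendPath n (shiftPath ((N - n : ℕ) : ℝ≥0) z)

/-- Changing the base level of the coordinate maps by a shift: for `N ≤ N'` and `J` below `N`,
`coordFamily J N' = coordFamily J N ∘ shiftPath (N' - N)`. [folklore] -/
theorem coordFamily_eq_comp_shiftPath {J : Finset ℕ} {N N' : ℕ} (hJ : ∀ n ∈ J, n ≤ N) (hNN' : N ≤ N') :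
    coordFamily J N' = coordFamily J N ∘ shiftPath ((N' - N : ℕ) : ℝ≥0) := by
  funext z; funext n
  simp only [coordFamily, comp_apply, shiftPath_shiftPath]
  have h : (N' - n : ℕ) = (N' - N) + (N - n) := by have := hJ n n.2; omega
  rw [h, Nat.cast_add]

/-- The consistency relation between consecutive frozen coordinates:
`extendPath n (shiftPath 1 z) = clampPath n (extendPath (n+1) z)`. [folklore] -/
theorem clampPath_extendPath_succ (n : ℕ) (z : C(ℝ≥0, ℝ)) :
    clampPath n (extendPath (n + 1) z) = extendPath n (shiftPath 1 z) := by
  rw [clampPath_extendPath (Nat.le_succ n)]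
  congr 2
  apply NNReal.eq
  simp

/-- The set of **consistent** coordinate families: `V n = clampPath n (V (n+1))` for all `n`, tested
on the rationals (a countable, measurable formulation). [folklore] -/
def consistentSet : Set (ℕ → C(ℝ, ℝ)) :=
  {V | ∀ n : ℕ, ∀ q : ℚ, V n q = V (n + 1) (max (q : ℝ) (-(n : ℝ)))}

/-- On the consistent set, `V n = clampPath n (V (n+1))`. [folklore] -/
theorem eq_clampPath_of_mem_consistentSet {V : ℕ → C(ℝ, ℝ)} (hV : V ∈ consistentSet) (n : ℕ) :
    V n = clampPath n (V (n + 1)) := by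
  -- two continuous functions agreeing on the rationals
  have hdense : Dense (Set.range ((↑) : ℚ → ℝ)) := Rat.denseRange_cast
  apply ContinuousMap.ext
  intro t
  have hcont1 : Continuous (V n : ℝ → ℝ) := (V n).continuous
  have hcont2 : Continuous (clampPath n (V (n + 1)) : ℝ → ℝ) := (clampPath n (V (n + 1))).continuous
  have heq : EqOn (V n : ℝ → ℝ) (clampPath n (V (n + 1))) (Set.range ((↑) : ℚ → ℝ)) := by
    rintro _ ⟨q, rfl⟩
    rw [clampPath_apply]
    exact hV n q
  exact congrFun (Continuous.ext_on hdense hcont1 hcont2 heq) t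

/-- On the consistent set, the values `V n t` do not depend on `n` as soon as `-n ≤ t`. [folklore] -/
theorem apply_eq_apply_of_mem_consistentSet {V : ℕ → C(ℝ, ℝ)} (hV : V ∈ consistentSet) {t : ℝ}
    {n m : ℕ} (hn : -(n : ℝ) ≤ t) (hnm : n ≤ m) : V n t = V m t := by
  induction hnm with
  | refl => rfl
  | @step k hk ih =>
    have hkt : -(k : ℝ) ≤ t := le_trans (by simpa using (Nat.cast_le (α := ℝ)).2 hk) hn
    rw [ih, eq_clampPath_of_mem_consistentSet hV k, clampPath_apply_of_le hkt]

/-- On the consistent set, `V N` is frozen before `-N`. [folklore] -/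
theorem clampPath_self_of_mem_consistentSet {V : ℕ → C(ℝ, ℝ)} (hV : V ∈ consistentSet) (N : ℕ) :
    clampPath N (V N) = V N := by
  ext t
  conv_rhs => rw [eq_clampPath_of_mem_consistentSet hV N]
  rw [eq_clampPath_of_mem_consistentSet hV N]
  simp only [clampPath_apply, max_eq_left (le_max_right t (-(N : ℝ)))]

/-- `-⌈|t|⌉ ≤ t`. [folklore] -/
theorem neg_ceil_abs_le (t : ℝ) : -((⌈|t|⌉₊ : ℕ) : ℝ) ≤ t := by
  have h1 : |t| ≤ (⌈|t|⌉₊ : ℝ) := Nat.le_ceil _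
  linarith [neg_abs_le t]

/-- **The glued two-sided path** of a consistent family: `t ↦ V_{⌈|t|⌉}(t)`, continuous because
locally it is one of the `V n`. [folklore] -/
def gluePath (V : ℕ → C(ℝ, ℝ)) (hV : V ∈ consistentSet) : C(ℝ, ℝ) where
  toFun t := V ⌈|t|⌉₊ t
  continuous_toFun := by
    refine continuous_iff_continuousAt.2 fun t₀ ↦ ?_
    set M : ℕ := ⌈|t₀|⌉₊ + 1 with hM
    have hloc : ∀ᶠ t in 𝓝 t₀, V ⌈|t|⌉₊ t = V M t := by
      have hball : Metric.ball t₀ 1 ∈ 𝓝 t₀ := Metric.ball_mem_nhds _ one_pos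
      filter_upwards [hball] with t ht
      rw [Metric.mem_ball, Real.dist_eq] at ht
      have habs : |t| ≤ |t₀| + 1 := by
        have := abs_sub_abs_le_abs_sub t t₀; linarith
      have hceil : ⌈|t|⌉₊ ≤ M := by
        rw [hM, ← Nat.ceil_add_one (abs_nonneg t₀)]
        exact Nat.ceil_mono habs
      exact apply_eq_apply_of_mem_consistentSet hV (neg_ceil_abs_le t) hceil
    exact ((V M).continuous.continuousAt).congr_of_eventuallyEq hloc

/-- Value of the glued path. [folklore] -/
theorem gluePath_apply (V : ℕ → C(ℝ, ℝ)) (hV : V ∈ consistentSet) (t : ℝ) : gluePath V hV t = V ⌈|t|⌉₊ t := rfl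

/-- **The clamps of the glued path are the coordinates.** [folklore] -/
theorem clampPath_gluePath (V : ℕ → C(ℝ, ℝ)) (hV : V ∈ consistentSet) (N : ℕ) :
    clampPath N (gluePath V hV) = V N := by
  conv_rhs => rw [← clampPath_self_of_mem_consistentSet hV N]
  ext t
  simp only [clampPath_apply, gluePath_apply]
  set u := max t (-(N : ℝ)) with hu
  have hN : -(N : ℝ) ≤ u := le_max_right _ _
  rcases le_total ⌈|u|⌉₊ N with h | h
  · exact apply_eq_apply_of_mem_consistentSet hV (neg_ceil_abs_le u) h
  · exact (apply_eq_apply_of_mem_consistentSet hV hN h).symm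

open Classical in
/-- **The gluing map** on all coordinate families (junk: the coordinate `V 0` off the consistent
set). [folklore] -/
def glue (V : ℕ → C(ℝ, ℝ)) : C(ℝ, ℝ) :=
  if hV : V ∈ consistentSet then gluePath V hV else V 0

/-- On the consistent set the gluing map is the glued path. [folklore] -/
theorem glue_of_mem {V : ℕ → C(ℝ, ℝ)} (hV : V ∈ consistentSet) : glue V = gluePath V hV := by
  rw [glue, dif_pos hV]

/-- On the consistent set, the clamps of the glued path are the coordinates. [folklore] -/
theorem clampPath_glue_of_mem {V : ℕ → C(ℝ, ℝ)} (hV : V ∈ consistentSet) (N : ℕ) : clampPath N (glue V) = V N := by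
  rw [glue_of_mem hV, clampPath_gluePath]

variable [MeasurableSpace C(ℝ≥0, ℝ)] [BorelSpace C(ℝ≥0, ℝ)] [MeasurableSpace C(ℝ, ℝ)] [BorelSpace C(ℝ, ℝ)]

/-- The coordinate maps are measurable. [folklore] -/
theorem measurable_coordFamily (J : Finset ℕ) (N : ℕ) : Measurable (coordFamily J N) :=
  measurable_pi_lambda _ fun n ↦
    ((continuous_extendPath n).comp (continuous_shiftPath _)).measurable

/-- **The finite-dimensional laws** of the frozen coordinates: `ν ∘ (coordFamily J (max J))⁻¹`.
[folklore] -/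
def fddFamily (ν : Measure C(ℝ≥0, ℝ)) (J : Finset ℕ) : Measure (∀ _ : J, C(ℝ, ℝ)) :=
  ν.map (coordFamily J (J.sup id))

/-- With a shift-invariant `ν`, the finite-dimensional law may be computed from any base level
`N ≥ max J`. [folklore] -/
theorem fddFamily_eq_map_of_le {ν : Measure C(ℝ≥0, ℝ)} (hν : ∀ h : ℝ≥0, ν.map (shiftPath h) = ν)
    (J : Finset ℕ) {N : ℕ} (hN : ∀ n ∈ J, n ≤ N) : fddFamily ν J = ν.map (coordFamily J N) := by
  have hsup : ∀ n ∈ J, n ≤ J.sup id := fun n hn ↦ Finset.le_sup (f := id) hn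
  have hle : J.sup id ≤ N := Finset.sup_le fun n hn ↦ hN n hn
  rw [fddFamily, coordFamily_eq_comp_shiftPath hsup hle,
    ← Measure.map_map (measurable_coordFamily J _) (continuous_shiftPath _).measurable, hν]

/-- **The finite-dimensional laws are projective** (shift-invariant `ν`). [folklore] -/
theorem isProjectiveMeasureFamily_fddFamily {ν : Measure C(ℝ≥0, ℝ)}
    (hν : ∀ h : ℝ≥0, ν.map (shiftPath h) = ν) :
    IsProjectiveMeasureFamily (α := fun _ : ℕ ↦ C(ℝ, ℝ)) (fddFamily ν) := by
  intro I J hJI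
  have hI : ∀ n ∈ I, n ≤ I.sup id := fun n hn ↦ Finset.le_sup (f := id) hn
  rw [fddFamily_eq_map_of_le hν J (N := I.sup id) (fun n hn ↦ hI n (hJI hn)), fddFamily,
    Measure.map_map (Finset.measurable_restrict₂ (X := fun _ : ℕ ↦ C(ℝ, ℝ)) hJI) (measurable_coordFamily I _)]
  rfl

/-- The finite-dimensional laws are probability measures. [folklore] -/
instance isProbabilityMeasure_fddFamily (ν : Measure C(ℝ≥0, ℝ)) [IsProbabilityMeasure ν] (J : Finset ℕ) :
    IsProbabilityMeasure (fddFamily ν J) :=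
  Measure.isProbabilityMeasure_map (measurable_coordFamily J _).aemeasurable

omit [MeasurableSpace C(ℝ≥0, ℝ)] [BorelSpace C(ℝ≥0, ℝ)] in
/-- The consistent set is measurable. [folklore] -/
theorem measurableSet_consistentSet : MeasurableSet (consistentSet : Set (ℕ → C(ℝ, ℝ))) := by
  have h : consistentSet = ⋂ n : ℕ, ⋂ q : ℚ, {V : ℕ → C(ℝ, ℝ) | V n q = V (n + 1) (max (q : ℝ) (-(n : ℝ)))} := by
    ext V; simp [consistentSet]
  rw [h]
  refine MeasurableSet.iInter fun n ↦ MeasurableSet.iInter fun q ↦ ?_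
  refine measurableSet_eq_fun ?_ ?_
  · exact (continuous_eval_const (q : ℝ)).measurable.comp (measurable_pi_apply n)
  · exact (continuous_eval_const _).measurable.comp (measurable_pi_apply (n + 1))

omit [MeasurableSpace C(ℝ≥0, ℝ)] [BorelSpace C(ℝ≥0, ℝ)] in
/-- **The gluing map is Borel measurable** (each evaluation is measurable). [folklore] -/
theorem measurable_glue : Measurable (glue : (ℕ → C(ℝ, ℝ)) → C(ℝ, ℝ)) := by
  classical
  have h := measurable_continuousMap_of_eval (Ω := ℕ → C(ℝ, ℝ)) (Φ := glue) (α := ℝ) (β := ℝ) fun t ↦ ?_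
  · convert h using 1
    exact BorelSpace.measurable_eq
  · have heq : (fun V : ℕ → C(ℝ, ℝ) ↦ glue V t) = fun V ↦ if V ∈ consistentSet then V ⌈|t|⌉₊ t else V 0 t := by
      funext V
      by_cases hV : V ∈ consistentSet
      · rw [glue_of_mem hV, if_pos hV, gluePath_apply]
      · rw [glue, dif_neg hV, if_neg hV]
    rw [heq]
    refine Measurable.ite measurableSet_consistentSet ?_ ?_
    · exact (continuous_eval_const t).measurable.comp (measurable_pi_apply _)
    · exact (continuous_eval_const t).measurable.comp (measurable_pi_apply 0)

/-- **Two-sided extension of a stationary continuous process.** For a shift-invariant Borel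
probability measure `ν` on `C([0, ∞), ℝ)` there is a Borel probability measure `P` on `C(ℝ, ℝ)`,
invariant under all two-sided time shifts, whose paths frozen before `-N` are, in law, the paths of
`ν` started at time `-N`: `P ∘ (clampPath N)⁻¹ = ν ∘ (extendPath N)⁻¹` for every `N`.
Kallenberg (2002), Ch. 10 (a stationary process on `ℝ₊` extends to `ℝ`), via the Kolmogorov
extension theorem (Thm 6.16) on the Polish path space `C(ℝ, ℝ)`. [cite: Kallenberg2002, Thm 6.16] -/
theorem exists_twoSided_extension (ν : Measure C(ℝ≥0, ℝ)) [IsProbabilityMeasure ν]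
    (hν : ∀ h : ℝ≥0, ν.map (shiftPath h) = ν) :
    ∃ P : Measure C(ℝ, ℝ), IsProbabilityMeasure P ∧ (∀ N : ℕ, P.map (clampPath N) = ν.map (extendPath N)) ∧
      ∀ s : ℝ, P.map (twoShift s) = P := by
  classical
  -- Kolmogorov extension on `ℕ → C(ℝ, ℝ)`
  have hproj := isProjectiveMeasureFamily_fddFamily hν
  obtain ⟨Q, hQ⟩ := exists_isProjectiveLimit_holds (ι := ℕ) (α := fun _ : ℕ ↦ C(ℝ, ℝ)) hproj
  haveI hQprob : IsProbabilityMeasure Q := hQ.isProbabilityMeasure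
  -- the one- and two-dimensional marginals
  have hmarg1 : ∀ N : ℕ, Q.map (fun V ↦ V N) = ν.map (extendPath N) := by
    intro N
    have h1 : (fun V : ℕ → C(ℝ, ℝ) ↦ V N) =
        (fun v : (∀ _ : ({N} : Finset ℕ), C(ℝ, ℝ)) ↦ v ⟨N, Finset.mem_singleton_self N⟩) ∘ ({N} : Finset ℕ).restrict := by
      funext V; rfl
    have hev : Measurable fun v : (∀ _ : ({N} : Finset ℕ), C(ℝ, ℝ)) ↦ v ⟨N, Finset.mem_singleton_self N⟩ :=
      measurable_pi_apply _
    rw [h1, ← Measure.map_map hev (Finset.measurable_restrict _), hQ {N},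
      fddFamily_eq_map_of_le hν {N} (N := N) (fun n hn ↦ by rw [Finset.mem_singleton.1 hn]),
      Measure.map_map hev (measurable_coordFamily _ _)]
    have h2 : (fun v : (∀ _ : ({N} : Finset ℕ), C(ℝ, ℝ)) ↦ v ⟨N, Finset.mem_singleton_self N⟩) ∘ coordFamily {N} N =
        extendPath N := by
      funext z
      simp [coordFamily]
    rw [h2]
  have hcons : ∀ᵐ V ∂Q, V ∈ consistentSet := by
    have hn : ∀ n : ℕ, ∀ᵐ V ∂Q, V n = clampPath n (V (n + 1)) := by
      intro n
      set J : Finset ℕ := {n, n + 1} with hJ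
      have hnJ : n ∈ J := by simp [hJ]
      have hn1J : n + 1 ∈ J := by simp [hJ]
      -- the relation as a measurable set of the `J`-coordinates
      set S : Set (∀ _ : J, C(ℝ, ℝ)) := {v | v ⟨n, hnJ⟩ = clampPath n (v ⟨n + 1, hn1J⟩)} with hS
      have hSm : MeasurableSet S := by
        refine (isClosed_eq ?_ ?_).measurableSet
        · exact continuous_apply _
        · exact (continuous_clampPath n).comp (continuous_apply _)
      have hSQ : Q (J.restrict ⁻¹' S) = 1 := by
        rw [← Measure.map_apply (Finset.measurable_restrict J) hSm, hQ J,
          fddFamily_eq_map_of_le hν J (N := n + 1) (fun m hm ↦ by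
            simp only [hJ, Finset.mem_insert, Finset.mem_singleton] at hm
            rcases hm with rfl | rfl <;> omega),
          Measure.map_apply (measurable_coordFamily J _) hSm]
        have hall : coordFamily J (n + 1) ⁻¹' S = univ := by
          refine eq_univ_of_forall fun z ↦ ?_
          simp only [hS, mem_preimage, mem_setOf_eq, coordFamily]
          rw [Nat.sub_self, Nat.add_sub_cancel_left]
          have : ((0 : ℕ) : ℝ≥0) = 0 := Nat.cast_zero
          rw [this, shiftPath_zero, Nat.cast_one]
          exact (clampPath_extendPath_succ n z).symm
        rw [hall, measure_univ]
      rw [ae_iff]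
      have hsub : {V : ℕ → C(ℝ, ℝ) | ¬V n = clampPath n (V (n + 1))} ⊆ (J.restrict ⁻¹' S)ᶜ := by
        intro V hV hVS
        exact hV hVS
      refine measure_mono_null hsub ?_
      exact (prob_compl_eq_zero_iff ((Finset.measurable_restrict J) hSm)).2 hSQ
    rw [← ae_all_iff] at hn
    filter_upwards [hn] with V hV
    intro n q
    rw [hV n, clampPath_apply]
  -- the two-sided law
  refine ⟨Q.map glue, Measure.isProbabilityMeasure_map measurable_glue.aemeasurable, ?_, ?_⟩
  · intro N
    rw [Measure.map_map (measurable_clampPath N) measurable_glue, ← hmarg1 N]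
    refine Measure.map_congr ?_
    filter_upwards [hcons] with V hV
    exact clampPath_glue_of_mem hV N
  · intro s
    haveI : IsProbabilityMeasure (Q.map glue) := Measure.isProbabilityMeasure_map measurable_glue.aemeasurable
    refine map_twoShift_eq_of_map_clampPath hν (fun N ↦ ?_) s
    rw [Measure.map_map (measurable_clampPath N) measurable_glue, ← hmarg1 N]
    refine Measure.map_congr ?_
    filter_upwards [hcons] with V hV
    exact clampPath_glue_of_mem hV N

end Extension

end Literature.Probability.Process
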